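import Summits.MatrixMultiplication.MatrixMultiplication.Theorems.FarEdgeDescentCeilingSteps
import HarnessLib

/-!
# Far-edge descent, kernel XXXIII-B: the CEILING of the isolated tower — order exactly `0.70951…`

Route `FarEdgeDescent`, special leaf `FiniteSaturation` (stmt-MatrixMultiplication-23739): helper
kernel, THESES-FREE and def-free.  Kernels XXXI-A/B + XXXII-A…D certify, from the isolated-anchor
improvable squaring tower on Schönhage's `E₃` (`r₀ = 10`, `Q₀ = 4`, `L₀ = 3`, `G₀(s,t) = 3^s`;
clock `2`: `r' = r²`, `L' = (Q+L)² − Q²`, `Q' = r' − 2L'`, virtual mass `G' = (Q^t + G)² − (Q^t)²`),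
`RateBeyond θ` for every `θ < θ_S = κ/(1−κ) = log(4/3)/log(3/2) = 0.70951…` (`κ = log₂(4/3)`):
every sub-tangent `(s,t)` of `y ↦ ω(1,y,1)` must pass the readouts `G_j(s,t) ≤ r_j`, and the readouts
FAIL outside the wedge `s − 1 ≤ C(1−t)^κ`.  This file proves the converse half — the CEILING of the
method as a theorem about the same numbers: the readouts PASS on a full wedge of the same exponent,

  `∃ c > 0:  s − 1 ≤ c·(1−t)^κ  ⟹  G_j(s,t) ≤ r_j / 2  for all j`        (`readout_of_wedge`),

for every numeric chain with the improvable recursion, `r₀ ≥ 2`, `3L₀ ≤ r₀` and a base census with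
`G₀(s,t) ≤ L₀(1 + D(s−1))` (`1 ≤ s ≤ 2`, `t ≤ 1`).  Consequences: the pass region is not contained in
any thinner wedge `s − 1 ≤ C'(1−t)^κ'`, `κ' > κ` (`wedge_not_thinner`); and the readouts are
CONSISTENT WITH THE POWER WORLD OF ORDER EXACTLY `θ_S` — there is `M > 0` such that every `(s,t)`
sub-tangent to the model profile `x ↦ x + 1 + M·x^(−θ_S)` passes every readout
(`readout_of_powerWorld`).  Since an excess `e(k) = ω(1,k,1) − (k+1) ≍ k^(−θ_S)` is thus compatible with
every certificate the tower produces, NO argument that uses only these readouts proves `RateBeyond θ`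
for any `θ > θ_S`, let alone `FiniteSaturation`: together with kernel XXXII-D the ORDER OF THE METHOD is
exactly `θ_S = 0.70951…` (kernel XXXIII-C instantiates everything on the `E₃` tower of record, over
every field, next to its certificate property and the upper wedge of kernel XXXI-B).

Mechanism (all in the ratios `m_j = L_j/r_j ≤ 1/3`, `ρ_j = 1 − 2m_j = Q_j/r_j`, `θ_j = Q_j^t/r_j ≤ ρ_j`,
`γ_j = G_j/r_j`; `m' = m(m+2ρ)`, `γ' = γ(γ+2θ)`):  PHASE 1 (anchor alive, `θ ≤ ρ`): `γ_j ≤ m_j(1+η_j)`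
with `η' ≤ (4/3)η + η²/3` (`phase_one_step`, using `m/(m+2ρ) ≤ 1/3`), whose orbit is majorised in
closed form by `E(a) = a/(1 − 3a/4)`, `a_j = (4/3)^j·D(s−1)` (`majorant_step`: the substitution
`ψ = η/(1+3η/4)` linearises the Riccati step); PHASE 2 (anchor dead, `Q_j^(t−1) ≤ 1/2` as soon as
`(1−t)(2^j log r₀ − log 3) ≥ log 2`, `anchor_death`): `γ_j ≤ (3/2)m_j` propagates (`phase_two_step`).
The junction stage `n` has `2^n ≍ 1/((1−t) log r₀)`, so `(4/3)^n = (2^n)^κ ≍ (1−t)^(−κ)` and phase 1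
stays below `a_n ≤ 1/4` exactly when `s − 1 ≲ (1−t)^κ` — the same exponent as the upper wedge, from the
same two facts (deviation multiplier `2(1−m) → 4/3`, anchor lifetime `2^n ≍ 1/(1−t)`).  Numerically
(instrument `wedge_probe.py` of the lens memo) the pass boundary of the `E₃` tower is
`s − 1 ∼ 1.7802·(1−t)^κ`, flat over fourteen decades of `1−t`.

* §1 `readout_of_wedge` — the ceiling of an improvable chain (scalar steps and the normal form
  `ceiling_virtualForm` are kernel XXXIII-A, `FarEdgeDescentCeilingSteps`).
* §2 `wedge_not_thinner`, `readout_of_powerWorld`.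
* Kernel XXXIII-C (`FarEdgeDescentIsolatedSandwich`) instantiates everything on the isolated towers of
  kernel XXXII-C (any base gadget: the order `θ_S` is base-independent) and on the `E₃` tower of
  record, next to its certificate property and the upper wedge of kernel XXXI-B.

References: Schönhage 1981, §5 (the `E₃` free lunch); Pan 1984 (LNCS 179) §16 Props. 16.2–16.5, §17
Thm. 17.1; Stothers 2010, Thm. 8; Knuth TAOCP 2, §4.6.4 Ex. 67(g); Lotti–Romani 1983, Prop. 4.1;
Alman–Li 2026, Thm. 5.1 / Prop. 5.3 (the budget count behind `Q + 2L = r`).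
Tags: `FiniteSaturation` (h₁) NEC · WEAKER · ATTACKED; rate ladder of first-order free-lunch towers
CAPPED at `θ_S = log(4/3)/log(3/2)` (this file = the cap as a theorem).
-/

set_option linter.dupNamespace false

noncomputable section

open scoped BigOperators

namespace Summit.MatrixMultiplication.MatrixMultiplication.Theorems.FarEdgeDescentIsolatedCeiling

open Literature.Computability.AlgebraicComplexity
open Summit.MatrixMultiplication.MatrixMultiplication.Theorems.FarEdgeDescentImprovableDynamics
open Summit.MatrixMultiplication.MatrixMultiplication.Theorems.FarEdgeDescentImprovableRate
open Summit.MatrixMultiplication.MatrixMultiplication.Theorems.FarEdgeDescentCeilingSteps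

/-! ## §1 The ceiling of an improvable chain -/

section Chain

variable (r Q L : ℕ → ℕ) (G : ℕ → ℝ → ℝ → ℝ)

/-- **THE CEILING: the readouts pass on a full `κ`-wedge.**  For a numeric chain with the
improvable recursion (`Q_j + 2L_j = r_j`, `Q_j ≥ 1`, `3L₀ ≤ r₀`, `r₀ ≥ 2`, `L' = (Q+L)² − Q²`, `r' = r²`,
`G' = (Q^t + G)² − (Q^t)²`, `G₀ ≥ 0`) and a base census `G₀(s,t) ≤ L₀(1 + D(s−1))` (`1 ≤ s ≤ 2`,
`t ≤ 1`), there is `c > 0` such that EVERY readout passes — `G_j(s,t) ≤ r_j/2` for all `j` — at every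
`(s,t)` with `1 ≤ s`, `0 ≤ t ≤ 1`, `s − 1 ≤ c(1−t)^κ`, `κ = log₂(4/3)`; explicitly
`c = 1/(4(D+1)(2 + 2 log 6/log r₀)^κ)`.  Hence no family of such readouts certifies a wedge exponent
above `κ`, i.e. a rate above `κ/(1−κ) = log(4/3)/log(3/2) = 0.70951…`.
[cite: Pan1984, Props. 16.2–16.5, Thm. 17.1] [cite: Stothers2010, Thm. 8] [cite: Schonhage1981, §5] -/
theorem readout_of_wedge (hr0 : 2 ≤ r 0)
    (hsum : ∀ j, Q j + 2 * L j = r j) (hQ1 : ∀ j, 1 ≤ Q j)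
    (hm0 : 3 * L 0 ≤ r 0) (hL : ∀ j, L (j + 1) = (Q j + L j) ^ 2 - Q j ^ 2)
    (hr : ∀ j, r (j + 1) = r j ^ 2) (hG0 : ∀ s t : ℝ, 0 ≤ G 0 s t)
    (hG : ∀ j (s t : ℝ), G (j + 1) s t = (((Q j : ℕ) : ℝ) ^ t + G j s t) ^ 2 - (((Q j : ℕ) : ℝ) ^ t) ^ 2)
    {D : ℝ} (hD : 0 ≤ D)
    (hUp : ∀ s t : ℝ, 1 ≤ s → s ≤ 2 → t ≤ 1 → G 0 s t ≤ (L 0 : ℝ) * (1 + D * (s - 1))) :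
    ∃ c : ℝ, 0 < c ∧ c ≤ 1 ∧ ∀ s t : ℝ, 1 ≤ s → 0 ≤ t → t ≤ 1 →
      s - 1 ≤ c * (1 - t) ^ Real.logb 2 ((4 : ℝ) / 3) → ∀ j, G j s t ≤ (r j : ℝ) / 2 := by
  obtain ⟨κ, hκ⟩ : ∃ κ : ℝ, κ = Real.logb 2 ((4 : ℝ) / 3) := ⟨_, rfl⟩
  obtain ⟨hκ0, hκ1⟩ := improvableKappa_pos_lt_one
  rw [← hκ] at hκ0 hκ1
  have hr0R : (2 : ℝ) ≤ r 0 := by exact_mod_cast hr0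
  have hℓ : 0 < Real.log (r 0) := Real.log_pos (by linarith)
  have hl6 : 0 < Real.log 6 := Real.log_pos (by norm_num)
  obtain ⟨B, hB⟩ : ∃ B : ℝ, B = 1 + Real.log 6 / Real.log (r 0) := ⟨_, rfl⟩
  have hB6 : Real.log 6 / Real.log (r 0) ≤ B := by rw [hB]; linarith
  have hB1 : 1 ≤ B := by
    have : 0 ≤ Real.log 6 / Real.log (r 0) := by positivity
    linarith
  have h2Bκ : 1 ≤ (2 * B) ^ κ := Real.one_le_rpow (by linarith) hκ0.le
  obtain ⟨c, hcdef⟩ : ∃ c : ℝ, c = 1 / (4 * (D + 1) * (2 * B) ^ κ) := ⟨_, rfl⟩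
  have hc0 : 0 < c := by rw [hcdef]; positivity
  have hc1 : c ≤ 1 := by
    rw [hcdef, div_le_one (by positivity)]
    nlinarith [mul_le_mul (show (1 : ℝ) ≤ D + 1 by linarith) h2Bκ zero_le_one (by positivity)]
  have hcD : D * c * (2 * B) ^ κ ≤ 1 / 4 := by
    have hP : (0 : ℝ) < (2 * B) ^ κ := by positivity
    have e : D * c * (2 * B) ^ κ = D / (4 * (D + 1)) := by
      rw [hcdef]
      field_simp
    rw [e, div_le_div_iff₀ (by positivity) (by norm_num)]
    linarith
  refine ⟨c, hc0, hc1, ?_⟩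
  rw [← hκ]
  intro s t hs1 ht0 ht1 hw j
  have hτ0 : 0 ≤ 1 - t := by linarith
  have hτ1 : 1 - t ≤ 1 := by linarith
  have hσ0 : 0 ≤ s - 1 := by linarith
  have hτκ1 : (1 - t) ^ κ ≤ 1 := Real.rpow_le_one hτ0 hτ1 hκ0.le
  have hs2 : s ≤ 2 := by
    have := mul_le_mul_of_nonneg_left hτκ1 hc0.le
    linarith
  obtain ⟨η₀, hη⟩ : ∃ η₀ : ℝ, η₀ = D * (s - 1) := ⟨_, rfl⟩
  have hη0 : 0 ≤ η₀ := by rw [hη]; positivity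
  have hup : G 0 s t ≤ (L 0 : ℝ) * (1 + η₀) := by rw [hη]; exact hUp s t hs1 hs2 ht1
  have NF := improvable_normalForm r Q L hsum hQ1 hm0 hL hr
  have VF := ceiling_virtualForm r Q L G hsum hQ1 hm0 hL hr hG0 hG (s := s) ht1
  have mono : ∀ i k, i ≤ k → ((4 : ℝ) / 3) ^ i * η₀ ≤ ((4 : ℝ) / 3) ^ k * η₀ := fun i k hik =>
    mul_le_mul_of_nonneg_right (pow_le_pow_right₀ (by norm_num) hik) hη0
  -- PHASE 1: γ_i ≤ m_i (1 + E(a_i)), a_i = (4/3)^i η₀, E(a) = a/(1 − 3a/4), while a_i ≤ 1/4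
  have P1 : ∀ i, ((4 : ℝ) / 3) ^ i * η₀ ≤ 1 / 4 →
      G i s t / r i ≤ (L i : ℝ) / r i *
        (1 + ((4 : ℝ) / 3) ^ i * η₀ / (1 - 3 / 4 * (((4 : ℝ) / 3) ^ i * η₀))) := by
    intro i
    induction i with
    | zero =>
      intro ha
      simp only [pow_zero, one_mul] at ha ⊢
      obtain ⟨hrpos, hm00, -, -, -⟩ := NF 0
      obtain ⟨hE1, -, -⟩ := majorant_le hη0 ha
      have h1 : G 0 s t / r 0 ≤ (L 0 : ℝ) / r 0 * (1 + η₀) := by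
        have h := div_le_div_of_nonneg_right hup hrpos.le
        calc G 0 s t / r 0 ≤ (L 0 : ℝ) * (1 + η₀) / r 0 := h
          _ = (L 0 : ℝ) / r 0 * (1 + η₀) := by ring
      exact h1.trans (mul_le_mul_of_nonneg_left (by linarith) hm00)
    | succ i ih =>
      intro ha
      have hai : ((4 : ℝ) / 3) ^ i * η₀ ≤ 1 / 4 := (mono i (i + 1) (by omega)).trans ha
      have hγi := ih hai
      obtain ⟨hrpos, hmi0, hmi3, hρ, hmrec⟩ := NF i
      obtain ⟨hθ0, hθρ, hγ0, hγrec, -⟩ := VF i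
      obtain ⟨-, hE0, hE2⟩ := majorant_le (by positivity : 0 ≤ ((4 : ℝ) / 3) ^ i * η₀) hai
      have hstep := phase_one_step hmi0 hmi3 hθ0 hθρ hE0 hγ0 hγi
      rw [← hγrec, ← hmrec] at hstep
      have hmaj := majorant_step (a := ((4 : ℝ) / 3) ^ i * η₀) (by positivity) (by linarith)
      have ea : ((4 : ℝ) / 3) ^ (i + 1) * η₀ = 4 / 3 * (((4 : ℝ) / 3) ^ i * η₀) := by
        rw [pow_succ]; ring
      rw [ea]
      obtain ⟨-, hm10, -, -, -⟩ := NF (i + 1)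
      exact hstep.trans (mul_le_mul_of_nonneg_left (by linarith) hm10)
  -- readout from a normalised bound
  have concl : ∀ i, G i s t / r i ≤ 1 / 2 → G i s t ≤ (r i : ℝ) / 2 := by
    intro i h
    obtain ⟨hrpos, -⟩ := NF i
    rw [div_le_iff₀ hrpos] at h
    linarith
  have fromP1 : ∀ i, ((4 : ℝ) / 3) ^ i * η₀ ≤ 1 / 4 → G i s t / r i ≤ 1 / 2 := by
    intro i ha
    have h := P1 i ha
    obtain ⟨-, hmi0, hmi3, -, -⟩ := NF i
    obtain ⟨-, hE0, hE2⟩ := majorant_le (by positivity : 0 ≤ ((4 : ℝ) / 3) ^ i * η₀) ha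
    calc G i s t / r i ≤ _ := h
      _ ≤ 1 / 3 * (1 + 1 / 2) := mul_le_mul hmi3 (by linarith) (by positivity) (by norm_num)
      _ ≤ 1 / 2 := by norm_num
  by_cases hτ : 1 - t = 0
  · -- `t = 1`: then `s = 1`, `η₀ = 0`, and phase 1 alone gives `γ_j ≤ m_j ≤ 1/3`
    have hs : s - 1 = 0 := by
      have h0 : (1 - t) ^ κ = 0 := by rw [hτ]; exact Real.zero_rpow hκ0.ne'
      rw [h0, mul_zero] at hw
      linarith
    have hη00 : η₀ = 0 := by rw [hη, hs, mul_zero]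
    apply concl
    apply fromP1
    rw [hη00, mul_zero]
    norm_num
  · have hτpos : 0 < 1 - t := lt_of_le_of_ne hτ0 (Ne.symm hτ)
    -- the junction stage `n`: first stage with `(1−t)·2ⁿ·log r₀ > log 6`
    obtain ⟨X, hX⟩ : ∃ X : ℝ, X = Real.log 6 / ((1 - t) * Real.log (r 0)) := ⟨_, rfl⟩
    have hXpos : 0 < X := by rw [hX]; positivity
    have hXτ : X * ((1 - t) * Real.log (r 0)) = Real.log 6 := by
      rw [hX]; field_simp
    obtain ⟨n, hn⟩ : ∃ n : ℕ, n = ⌊Real.logb 2 X⌋₊ + 1 := ⟨_, rfl⟩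
    have F1 : X < (2 : ℝ) ^ n := by
      have h1 := Nat.lt_floor_add_one (Real.logb 2 X)
      have h2 := Real.rpow_lt_rpow_of_exponent_lt (by norm_num : (1 : ℝ) < 2) h1
      rw [Real.rpow_logb (by norm_num) (by norm_num) hXpos] at h2
      rw [hn, ← Real.rpow_natCast]
      push_cast
      exact h2
    have hdead : ∀ i, n ≤ i → Real.log 2 ≤ (1 - t) * (2 ^ i * Real.log (r 0) - Real.log 3) := by
      intro i hi
      have h2i : (2 : ℝ) ^ n ≤ 2 ^ i := pow_le_pow_right₀ (by norm_num) hi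
      have h6 : Real.log 6 = Real.log 2 + Real.log 3 := by
        rw [show (6 : ℝ) = 2 * 3 by norm_num, Real.log_mul (by norm_num) (by norm_num)]
      have hl3 : 0 < Real.log 3 := Real.log_pos (by norm_num)
      have hA : Real.log 6 < (1 - t) * (2 ^ n * Real.log (r 0)) := by
        have h := mul_lt_mul_of_pos_right F1 (show 0 < (1 - t) * Real.log (r 0) by positivity)
        rw [hXτ] at h
        linarith
      have h3 : (1 - t) * Real.log 3 ≤ Real.log 3 := by nlinarith
      have h4 : (1 - t) * (2 ^ n * Real.log (r 0)) ≤ (1 - t) * (2 ^ i * Real.log (r 0)) :=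
        mul_le_mul_of_nonneg_left (mul_le_mul_of_nonneg_right h2i hℓ.le) hτ0
      have e : (1 - t) * (2 ^ i * Real.log (r 0) - Real.log 3) =
          (1 - t) * (2 ^ i * Real.log (r 0)) - (1 - t) * Real.log 3 := by ring
      rw [e]
      linarith
    have F2 : (2 : ℝ) ^ n * (1 - t) ≤ 2 * B := by
      have key : (2 : ℝ) ^ ⌊Real.logb 2 X⌋₊ * (1 - t) ≤ B := by
        by_cases hlx : 0 ≤ Real.logb 2 X
        · have hfl : ((⌊Real.logb 2 X⌋₊ : ℕ) : ℝ) ≤ Real.logb 2 X := Nat.floor_le hlx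
          have h := Real.rpow_le_rpow_of_exponent_le (by norm_num : (1 : ℝ) ≤ 2) hfl
          rw [Real.rpow_natCast, Real.rpow_logb (by norm_num) (by norm_num) hXpos] at h
          have hXτ' : X * (1 - t) = Real.log 6 / Real.log (r 0) := by
            rw [hX]; field_simp
          calc (2 : ℝ) ^ ⌊Real.logb 2 X⌋₊ * (1 - t) ≤ X * (1 - t) := mul_le_mul_of_nonneg_right h hτ0
            _ = Real.log 6 / Real.log (r 0) := hXτ'
            _ ≤ B := hB6
        · push Not at hlx
          rw [Nat.floor_of_nonpos hlx.le, pow_zero, one_mul]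
          linarith
      rw [hn, pow_succ]
      nlinarith
    have F3 : ((4 : ℝ) / 3) ^ n * η₀ ≤ 1 / 4 := by
      have e1 : ((4 : ℝ) / 3) ^ n = ((2 : ℝ) ^ n) ^ κ := by rw [hκ]; exact fourThirds_pow_eq n
      have h1 : ((2 : ℝ) ^ n) ^ κ * (1 - t) ^ κ = ((2 : ℝ) ^ n * (1 - t)) ^ κ :=
        (Real.mul_rpow (by positivity) hτ0).symm
      have h2 : ((2 : ℝ) ^ n * (1 - t)) ^ κ ≤ (2 * B) ^ κ :=
        Real.rpow_le_rpow (by positivity) F2 hκ0.le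
      have hw' : η₀ ≤ D * (c * (1 - t) ^ κ) := by rw [hη]; exact mul_le_mul_of_nonneg_left hw hD
      calc ((4 : ℝ) / 3) ^ n * η₀ ≤ ((4 : ℝ) / 3) ^ n * (D * (c * (1 - t) ^ κ)) :=
            mul_le_mul_of_nonneg_left hw' (by positivity)
        _ = D * c * (((2 : ℝ) ^ n) ^ κ * (1 - t) ^ κ) := by rw [e1]; ring
        _ ≤ D * c * (2 * B) ^ κ := by
            rw [h1]; exact mul_le_mul_of_nonneg_left h2 (by positivity)
        _ ≤ 1 / 4 := hcD
    -- PHASE 2: γ_i ≤ (3/2) m_i from the junction on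
    have P2 : ∀ i, n ≤ i → G i s t / r i ≤ 3 / 2 * ((L i : ℝ) / r i) := by
      intro i hi
      induction i, hi using Nat.le_induction with
      | base =>
        have h := P1 n F3
        obtain ⟨-, hmn0, -, -, -⟩ := NF n
        obtain ⟨-, hE0, hE2⟩ := majorant_le (by positivity : 0 ≤ ((4 : ℝ) / 3) ^ n * η₀) F3
        calc G n s t / r n ≤ _ := h
          _ ≤ (L n : ℝ) / r n * (1 + 1 / 2) := mul_le_mul_of_nonneg_left (by linarith) hmn0
          _ = 3 / 2 * ((L n : ℝ) / r n) := by ring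
      | succ i hi ih =>
        obtain ⟨hrpos, hmi0, hmi3, hρ, hmrec⟩ := NF i
        obtain ⟨hθ0, -, hγ0, hγrec, hd⟩ := VF i
        have hstep := phase_two_step hmi0 hmi3 hθ0 (hd (hdead i hi)) hγ0 ih
        rw [← hγrec, ← hmrec] at hstep
        exact hstep
    apply concl
    rcases lt_or_ge j n with hj | hj
    · exact fromP1 j ((mono j n hj.le).trans F3)
    · obtain ⟨-, -, hmj3, -, -⟩ := NF j
      have h := P2 j hj
      linarith

/-! ## §2 Consequences: no thinner wedge; the power world of order `θ_S` passes -/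

/-- **The pass region is not inside any thinner wedge.**  For every `κ' > κ = log₂(4/3)` and every
`C'` there is `(s,t)` (`1 < s`, `0 ≤ t < 1`) OUTSIDE the wedge `s − 1 ≤ C'(1−t)^κ'` at which every
readout passes.  So the readouts of an improvable chain certify no wedge exponent above `κ`.
[cite: Pan1984, Thm. 17.1] [cite: Stothers2010, Thm. 8] -/
theorem wedge_not_thinner (hr0 : 2 ≤ r 0)
    (hsum : ∀ j, Q j + 2 * L j = r j) (hQ1 : ∀ j, 1 ≤ Q j)
    (hm0 : 3 * L 0 ≤ r 0) (hL : ∀ j, L (j + 1) = (Q j + L j) ^ 2 - Q j ^ 2)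
    (hr : ∀ j, r (j + 1) = r j ^ 2) (hG0 : ∀ s t : ℝ, 0 ≤ G 0 s t)
    (hG : ∀ j (s t : ℝ), G (j + 1) s t = (((Q j : ℕ) : ℝ) ^ t + G j s t) ^ 2 - (((Q j : ℕ) : ℝ) ^ t) ^ 2)
    {D : ℝ} (hD : 0 ≤ D)
    (hUp : ∀ s t : ℝ, 1 ≤ s → s ≤ 2 → t ≤ 1 → G 0 s t ≤ (L 0 : ℝ) * (1 + D * (s - 1)))
    {κ' : ℝ} (hκ' : Real.logb 2 ((4 : ℝ) / 3) < κ') (C' : ℝ) :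
    ∃ s t : ℝ, 1 < s ∧ 0 ≤ t ∧ t < 1 ∧ C' * (1 - t) ^ κ' < s - 1 ∧
      ∀ j, G j s t ≤ (r j : ℝ) / 2 := by
  obtain ⟨c, hc0, -, hW⟩ := readout_of_wedge r Q L G hr0 hsum hQ1 hm0 hL hr hG0 hG hD hUp
  obtain ⟨κ, hκ⟩ : ∃ κ : ℝ, κ = Real.logb 2 ((4 : ℝ) / 3) := ⟨_, rfl⟩
  obtain ⟨hκ0, -⟩ := improvableKappa_pos_lt_one
  rw [← hκ] at hκ0 hW hκ'
  by_cases hC : C' ≤ 0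
  · refine ⟨1 + c, 0, by linarith, le_rfl, by norm_num, ?_, fun j => hW (1 + c) 0 (by linarith) le_rfl
      (by norm_num) ?_ j⟩
    · rw [sub_zero, Real.one_rpow, mul_one]; linarith
    · rw [sub_zero, Real.one_rpow, mul_one]; linarith
  · push Not at hC
    have hd : 0 < κ' - κ := by linarith
    have hq0 : 0 < c / (c + 2 * C') := by positivity
    have hq1 : c / (c + 2 * C') < 1 := by rw [div_lt_one (by positivity)]; linarith
    obtain ⟨τ, hτ⟩ : ∃ τ : ℝ, τ = (c / (c + 2 * C')) ^ (1 / (κ' - κ)) := ⟨_, rfl⟩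
    have hτ0 : 0 < τ := by rw [hτ]; exact Real.rpow_pos_of_pos hq0 _
    have hτ1 : τ < 1 := by rw [hτ]; exact Real.rpow_lt_one hq0.le hq1 (by positivity)
    have hτd : τ ^ (κ' - κ) = c / (c + 2 * C') := by
      rw [hτ, ← Real.rpow_mul hq0.le, one_div_mul_cancel hd.ne', Real.rpow_one]
    have hτκ : 0 < τ ^ κ := Real.rpow_pos_of_pos hτ0 κ
    refine ⟨1 + c * τ ^ κ, 1 - τ, by nlinarith, by linarith, by linarith, ?_,
      fun j => hW _ _ (by nlinarith) (by linarith) (by linarith) (by rw [sub_sub_cancel]; linarith) j⟩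
    rw [sub_sub_cancel, add_sub_cancel_left,
      show κ' = (κ' - κ) + κ by ring, Real.rpow_add hτ0, hτd]
    have hlt : C' * (c / (c + 2 * C')) < c := by
      rw [← mul_div_assoc, div_lt_iff₀ (by positivity)]
      nlinarith
    calc C' * (c / (c + 2 * C') * τ ^ κ) = C' * (c / (c + 2 * C')) * τ ^ κ := by ring
      _ < c * τ ^ κ := mul_lt_mul_of_pos_right hlt hτκ

/-- **The power world of order exactly `θ_S` passes every readout.**  There is `M > 0` such that
every `(s,t)` (`1 ≤ s`, `0 ≤ t < 1`) sub-tangent to the model profile `x ↦ x + 1 + M·x^(−θ_S)`,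
`θ_S = κ/(1−κ) = log(4/3)/log(3/2)`, satisfies `G_j(s,t) ≤ r_j/2` for all `j`: such sub-tangents have
`s − 1 ≤ inf_x (M x^(−θ_S) + (1−t)x) ≤ c(1−t)^κ` (evaluate at `x = (c/2)(1−t)^(κ−1)`).  An excess
`e(k) ≍ k^(−θ_S)` is therefore compatible with every certificate of the chain.
[cite: Pan1984, Thm. 17.1] [cite: Stothers2010, Thm. 8] [cite: LottiRomani1983, Prop. 4.1] -/
theorem readout_of_powerWorld (hr0 : 2 ≤ r 0)
    (hsum : ∀ j, Q j + 2 * L j = r j) (hQ1 : ∀ j, 1 ≤ Q j)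
    (hm0 : 3 * L 0 ≤ r 0) (hL : ∀ j, L (j + 1) = (Q j + L j) ^ 2 - Q j ^ 2)
    (hr : ∀ j, r (j + 1) = r j ^ 2) (hG0 : ∀ s t : ℝ, 0 ≤ G 0 s t)
    (hG : ∀ j (s t : ℝ), G (j + 1) s t = (((Q j : ℕ) : ℝ) ^ t + G j s t) ^ 2 - (((Q j : ℕ) : ℝ) ^ t) ^ 2)
    {D : ℝ} (hD : 0 ≤ D)
    (hUp : ∀ s t : ℝ, 1 ≤ s → s ≤ 2 → t ≤ 1 → G 0 s t ≤ (L 0 : ℝ) * (1 + D * (s - 1))) :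
    ∃ M : ℝ, 0 < M ∧ ∀ s t : ℝ, 1 ≤ s → 0 ≤ t → t < 1 →
      (∀ x : ℝ, 0 < x → s + x * t ≤ x + 1 +
        M * x ^ (-(Real.logb 2 ((4 : ℝ) / 3) / (1 - Real.logb 2 ((4 : ℝ) / 3))))) →
      ∀ j, G j s t ≤ (r j : ℝ) / 2 := by
  obtain ⟨c, hc0, -, hW⟩ := readout_of_wedge r Q L G hr0 hsum hQ1 hm0 hL hr hG0 hG hD hUp
  obtain ⟨κ, hκ⟩ : ∃ κ : ℝ, κ = Real.logb 2 ((4 : ℝ) / 3) := ⟨_, rfl⟩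
  obtain ⟨hκ0, hκ1⟩ := improvableKappa_pos_lt_one
  rw [← hκ] at hκ0 hκ1 hW
  rw [← hκ]
  obtain ⟨θ, hθ⟩ : ∃ θ : ℝ, θ = κ / (1 - κ) := ⟨_, rfl⟩
  have hθ0 : 0 < θ := by rw [hθ]; exact div_pos hκ0 (by linarith)
  rw [← hθ]
  have hl0 : 0 < c / 2 := by positivity
  refine ⟨c / 2 * (c / 2) ^ θ, by positivity, ?_⟩
  intro s t hs1 ht0 ht1 hsub j
  have hτ : 0 < 1 - t := by linarith
  -- evaluate the sub-tangent inequality at x = (c/2)(1−t)^(κ−1)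
  have hx : 0 < c / 2 * (1 - t) ^ (κ - 1) := mul_pos hl0 (Real.rpow_pos_of_pos hτ _)
  have h := hsub _ hx
  have e1 : c / 2 * (1 - t) ^ (κ - 1) * (1 - t) = c / 2 * (1 - t) ^ κ := by
    rw [mul_assoc, ← Real.rpow_add_one hτ.ne', sub_add_cancel]
  have h1κ : (1 : ℝ) - κ ≠ 0 := (sub_pos.2 hκ1).ne'
  have eθ : (κ - 1) * -θ = κ := by
    rw [hθ]
    field_simp
    ring
  have e2 : c / 2 * (c / 2) ^ θ * (c / 2 * (1 - t) ^ (κ - 1)) ^ (-θ) = c / 2 * (1 - t) ^ κ := by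
    rw [Real.mul_rpow hl0.le (Real.rpow_nonneg hτ.le _), ← Real.rpow_mul hτ.le, eθ,
      Real.rpow_neg hl0.le]
    have hp : (c / 2) ^ θ ≠ 0 := (Real.rpow_pos_of_pos hl0 θ).ne'
    field_simp
  refine hW s t hs1 ht0 ht1.le ?_ j
  have key : s - 1 ≤ c / 2 * (1 - t) ^ (κ - 1) * (1 - t) +
      c / 2 * (c / 2) ^ θ * (c / 2 * (1 - t) ^ (κ - 1)) ^ (-θ) := by
    nlinarith
  rw [e1, e2] at key
  linarith

end Chain

end Summit.MatrixMultiplication.MatrixMultiplication.Theorems.FarEdgeDescentIsolatedCeiling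

end
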